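import Summits.HodgeConjecture.HodgeConjecture.Theses.PadicSemiregularLift
import Summits.HodgeConjecture.HodgeConjecture.Theorems.PadicSemiregularLiftFormalLiftingFromClassLiftingGlue
import Literature.AlgebraicGeometry.Motives.HodgeSheaves

/-!
# Sketch — crux-ideate round 2, ideator 5 (crux stmt-HodgeConjecture-13825 `FormalLiftingFromClassLifting`)

First lemmas of the idea card `degeneracy-divisor-rank-one` (PORTEOUS / MARUYAMA RANK-ONE-ISATION):
on a variety of dimension `≤ 3`, `r` general sections of `F(N)` (`F` of rank `r`) have corank `≤ 1`
everywhere (the corank-2 locus has codimension 4), so `F(N)/𝒪^r = i_*𝓛` with `𝓛` a LINE BUNDLE on the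
degeneracy divisor `D = V(det s)`, hence `[F(N)] = r[𝒪] + [i_*𝓛]` in `K₀(X_{n+1})`, and the premise of
(⋆) — "`[F] ∈ im(K₀(X_{n+2}) → K₀(X_{n+1}))`" — follows as soon as ONE Noether–Lefschetz pair `(D, 𝓛)`
lifts one step. For `d ≤ 2` the divisor is a curve and its Picard functor is unobstructed, so integral
step class lifting follows from "`det F` extends" alone (`SurfaceStepClassLiftingFromDet`); for `d = 3`
the residue is one rank-one statement (`StepClassLiftingFromDet`, the `d = 3` instances). The
determinant is typed with the tree's sheafified exterior power `exteriorPowerSheaf` and `HasRank`.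

All `def`s below are `Prop`s over existing declarations; the two theorems are the sorry-free
compositions with the LANDED glue `Glue.liftsFormally_of_stepClassLifting` (p76799).
-/

set_option linter.dupNamespace false

namespace Summit.HodgeConjecture.HodgeConjecture.Cruxes.FormalLiftingFromClassLifting.IdeatorFive

open CategoryTheory AlgebraicGeometry Limits
open Literature.AlgebraicGeometry Literature.AlgebraicGeometry.Motives
open Literature.AlgebraicGeometry.Motives.WittScheme
open Summit.HodgeConjecture.HodgeConjecture.Theses.PadicSemiregularLift

noncomputable section

section Det

variable {X : Scheme.{0}}

/-- `L` is a determinant of the rank-`r` module `V`: `V` has constant rank `r`, `L` has rank `1`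
and `L ≅ ⋀ʳ V` (the tree's sheafified exterior power `exteriorPowerSheaf`, Motives/HodgeSheaves). -/
def IsDetOf (V L : X.Modules) (r : ℕ) : Prop :=
  HasRank V r ∧ HasRank L 1 ∧ Nonempty (L ≅ exteriorPowerSheaf V r)

end Det

section Pairs

variable {p : ℕ} [Fact p.Prime] {k : Type} [Field k] [CharP k p]
  (𝒳 : SchemeOver (WittVector p k))

/-- **The rank-one premise** for a finite locally free `F` on `X_{n+1}`: its determinant line bundle
extends to a line bundle on `X_{n+2}` (weight 1 only). -/
def DetExtends (n : ℕ) (F : (thickening 𝒳 (n + 1)).left.Modules) : Prop :=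
  ∃ (r : ℕ) (L : (thickening 𝒳 (n + 1)).left.Modules) (L' : (thickening 𝒳 (n + 2)).left.Modules),
    IsDetOf F L r ∧ HasRank L' 1 ∧
      Nonempty ((Scheme.Modules.pullback (thickeningMap 𝒳 (Nat.le_succ (n + 1)))).obj L' ≅ L)

/-- The premise of hypothesis (⋆) for `F`: its integral `K₀`-class lifts one step. -/
def ClassLiftsOneStep (n : ℕ) (F : (thickening 𝒳 (n + 1)).left.Modules)
    (hF : IsFiniteLocallyFree F) : Prop :=
  ∃ y : KTheory.KZero (thickening 𝒳 (n + 2)).left,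
    KTheory.KZero.map (thickeningMap 𝒳 (Nat.le_succ (n + 1))) y = KTheory.KZero.of F hF

end Pairs

/-- **FIRST LEMMA (d ≤ 2 corner, the lever's theorem on paper).** On a smooth projective `W(k)`-model
of relative dimension `d ≤ 2`, a finite locally free `F` on `X_{n+1}` whose DETERMINANT extends to
`X_{n+2}` has its integral `K₀`-class in the image of `K₀(X_{n+2}) → K₀(X_{n+1})`. Paper proof
(rank-one-isation): for `N ≫ 0` and `r` general sections `s : 𝒪^r → F(N)` (lifted from `X_k`,
`H¹ = 0`), `coker s = i_*𝓛` with `𝓛` invertible on the relative CURVE `D = V(det s)`; `D` extends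
because `det F(N)` and its section do (`H¹(X_k, det E₁(rN)) = 0`), `𝓛` extends because
`H²(D_k, 𝒪) = 0`; `[F(N)] = r[𝒪] + [i'_*𝓛']|` by Schanuel on two 2-term resolutions; untwist. No
torsion hypothesis, no `K`-theory of thickenings beyond `K₀` bookkeeping. (For finite `k`, "general
sections" after two finite étale base changes of coprime degrees; the CLASS statement descends by
additivity of `π_*π^*`.) -/
def SurfaceStepClassLiftingFromDet : Prop :=
  ∀ (p : ℕ) [Fact p.Prime] (k : Type) [Field k] [CharP k p] [PerfectRing k p] (d : ℕ)
    (𝒳 : SchemeOver (WittVector p k)), IsSmoothProperModel d 𝒳 →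
    Crystalline.IsProjectiveOverRing 𝒳 → d ≤ 2 →
    ∀ (n : ℕ) (F : (thickening 𝒳 (n + 1)).left.Modules) (hF : IsFiniteLocallyFree F),
      DetExtends 𝒳 n F → ClassLiftsOneStep 𝒳 n F hF

/-- **The `d ≤ 3` target of the line** (covers the first lemma for `d ≤ 2`; for `d = 3` it is the
Noether–Lefschetz-pair residue `NLPairStepLifting` of the card): under the crux's hypotheses on `𝒳`
with `d ≤ 3`, every finite locally free finite-level lift `F` of a rationally pro-liftable `E₁` whose
determinant extends one step has its class lifting one step. For `d = 3` the degeneracy divisor `D` is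
a relative SURFACE and `𝓛 = coker s|_D` is Noether–Lefschetz special; the claim is that some extension
`D' ⊂ X_{n+2}` of `D` carries an extension of `𝓛` (a `W_{n+2}`-point of the formal Noether–Lefschetz
locus of `c₁(𝓛)` over the given `W_{n+1}`-point). TRUE on paper as a CLASS statement (disprover's (E)/(H),
via relative `K`-theory); the card's bet is the rank-one proof. -/
def StepClassLiftingFromDet : Prop :=
  ∀ (p : ℕ) [Fact p.Prime] (k : Type) [Field k] [CharP k p] [PerfectRing k p] (d : ℕ)
    (𝒳 : SchemeOver (WittVector p k)), IsSmoothProperModel d 𝒳 →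
    Crystalline.IsProjectiveOverRing 𝒳 → d + 6 < p →
    (∀ (b : ℕ) (x : structureSheafCohomology 𝒳.left b), (p : ℤ) • x = 0 → x = 0) →
    (∀ (b : ℕ) (x : hodgeCohomologyOne 𝒳 b), (p : ℤ) • x = 0 → x = 0) → d ≤ 3 →
    ∀ (E₁ : (specialFibre 𝒳).left.Modules) (hE₁ : IsFiniteLocallyFree E₁),
      (∃ ξ : KTheory.ContinuousKZeroRat (Ideal.span {(p : WittVector p k)}) 𝒳,
        KTheory.KZeroRat.map (Crystalline.specialFibreToTower 𝒳)
          (KTheory.ContinuousKZeroRat.specialFibre (Ideal.span {(p : WittVector p k)}) 𝒳 ξ) =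
          KTheory.KZeroRat.of E₁ hE₁) →
      ∀ (n : ℕ) (F : (thickening 𝒳 (n + 1)).left.Modules) (hF : IsFiniteLocallyFree F),
        Nonempty ((Scheme.Modules.pullback (specialFibreToThickening 𝒳 n)).obj F ≅ E₁) →
        DetExtends 𝒳 n F → ClassLiftsOneStep 𝒳 n F hF

/-- **The weight-1 engine** (rank one; Berthelot–Ogus 3.8 with `t = 0` + Pic Bockstein, both from
`H²(𝒳,𝒪)[p] = 0`; in the card via the truncated logarithm `Θ : Pic(X_k) → H²(𝒳̂, 𝒪)`): under the crux's
hypotheses, for a rationally pro-liftable `E₁`, the determinant of EVERY finite-level finite locally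
free lift `F` of `E₁` extends one more step (`det E₁(rN)` lifts formally by `Θ`-saturation, and all
finite lifts of a formally liftable line bundle extend by Bockstein vanishing). -/
def DetEngine : Prop :=
  ∀ (p : ℕ) [Fact p.Prime] (k : Type) [Field k] [CharP k p] [PerfectRing k p] (d : ℕ)
    (𝒳 : SchemeOver (WittVector p k)), IsSmoothProperModel d 𝒳 →
    Crystalline.IsProjectiveOverRing 𝒳 → d + 6 < p →
    (∀ (b : ℕ) (x : structureSheafCohomology 𝒳.left b), (p : ℤ) • x = 0 → x = 0) →
    (∀ (b : ℕ) (x : hodgeCohomologyOne 𝒳 b), (p : ℤ) • x = 0 → x = 0) →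
    ∀ (E₁ : (specialFibre 𝒳).left.Modules) (hE₁ : IsFiniteLocallyFree E₁),
      (∃ ξ : KTheory.ContinuousKZeroRat (Ideal.span {(p : WittVector p k)}) 𝒳,
        KTheory.KZeroRat.map (Crystalline.specialFibreToTower 𝒳)
          (KTheory.ContinuousKZeroRat.specialFibre (Ideal.span {(p : WittVector p k)}) 𝒳 ξ) =
          KTheory.KZeroRat.of E₁ hE₁) →
      ∀ (n : ℕ) (F : (thickening 𝒳 (n + 1)).left.Modules) (_ : IsFiniteLocallyFree F),
        Nonempty ((Scheme.Modules.pullback (specialFibreToThickening 𝒳 n)).obj F ≅ E₁) →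
        DetExtends 𝒳 n F

/-- The `Ω¹`-free half of the crux, verbatim (the disprover's `CruxOmegaFree`; NOT addressed by this
lever — recorded so that the composition below concludes the crux by name). -/
def CruxOmegaFree : Prop :=
  ∀ (p : ℕ) [Fact p.Prime] (k : Type) [Field k] [CharP k p] [PerfectRing k p] (d : ℕ)
    (𝒳 : SchemeOver (WittVector p k)), IsSmoothProperModel d 𝒳 →
    Crystalline.IsProjectiveOverRing 𝒳 → d + 6 < p →
    (∀ (b : ℕ) (x : structureSheafCohomology 𝒳.left b), (p : ℤ) • x = 0 → x = 0) →
    (∀ (b : ℕ) (x : hodgeCohomologyOne 𝒳 b), (p : ℤ) • x = 0 → x = 0) →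
    Nonempty (cotangentSheaf 𝒳 ≅ SheafOfModules.free (R := 𝒳.left.ringCatSheaf) (Fin d)) →
    ∀ (E₁ : (specialFibre 𝒳).left.Modules) (hE₁ : IsFiniteLocallyFree E₁),
      (∀ (n : ℕ) (F : (thickening 𝒳 (n + 1)).left.Modules) (hF : IsFiniteLocallyFree F),
        Nonempty ((Scheme.Modules.pullback (specialFibreToThickening 𝒳 n)).obj F ≅ E₁) →
        ClassLiftsOneStep 𝒳 n F hF →
        ∃ F' : (thickening 𝒳 (n + 2)).left.Modules, IsFiniteLocallyFree F' ∧
          Nonempty ((Scheme.Modules.pullback (thickeningMap 𝒳 (Nat.le_succ (n + 1)))).obj F' ≅ F)) →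
      (∃ ξ : KTheory.ContinuousKZeroRat (Ideal.span {(p : WittVector p k)}) 𝒳,
        KTheory.KZeroRat.map (Crystalline.specialFibreToTower 𝒳)
          (KTheory.ContinuousKZeroRat.specialFibre (Ideal.span {(p : WittVector p k)}) 𝒳 ξ) =
          KTheory.KZeroRat.of E₁ hE₁) →
      LiftsFormally 𝒳 E₁

/-- **COMPOSITION (sorry-free): weight-1 engine + rank-one-ised step lifting ⇒ the `d ≤ 3` half of
the crux**, through the LANDED reduction `Glue.liftsFormally_of_stepClassLifting` (p76799). -/
theorem liftsFormally_lowDim_of_detEngine_of_stepFromDet (hE : DetEngine) (hS : StepClassLiftingFromDet)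
    (p : ℕ) [Fact p.Prime] (k : Type) [Field k] [CharP k p] [PerfectRing k p] (d : ℕ)
    (𝒳 : SchemeOver (WittVector p k)) (h𝒳 : IsSmoothProperModel d 𝒳)
    (hproj : Crystalline.IsProjectiveOverRing 𝒳) (hp : d + 6 < p)
    (hO : ∀ (b : ℕ) (x : structureSheafCohomology 𝒳.left b), (p : ℤ) • x = 0 → x = 0)
    (hΩ : ∀ (b : ℕ) (x : hodgeCohomologyOne 𝒳 b), (p : ℤ) • x = 0 → x = 0) (hd : d ≤ 3)
    (E₁ : (specialFibre 𝒳).left.Modules) (hE₁ : IsFiniteLocallyFree E₁)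
    (hstar : ∀ (n : ℕ) (F : (thickening 𝒳 (n + 1)).left.Modules) (hF : IsFiniteLocallyFree F),
      Nonempty ((Scheme.Modules.pullback (specialFibreToThickening 𝒳 n)).obj F ≅ E₁) →
      ClassLiftsOneStep 𝒳 n F hF →
      ∃ F' : (thickening 𝒳 (n + 2)).left.Modules, IsFiniteLocallyFree F' ∧
        Nonempty ((Scheme.Modules.pullback (thickeningMap 𝒳 (Nat.le_succ (n + 1)))).obj F' ≅ F))
    (hr : ∃ ξ : KTheory.ContinuousKZeroRat (Ideal.span {(p : WittVector p k)}) 𝒳,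
        KTheory.KZeroRat.map (Crystalline.specialFibreToTower 𝒳)
          (KTheory.ContinuousKZeroRat.specialFibre (Ideal.span {(p : WittVector p k)}) 𝒳 ξ) =
          KTheory.KZeroRat.of E₁ hE₁) :
    LiftsFormally 𝒳 E₁ :=
  Summit.HodgeConjecture.HodgeConjecture.Theorems.FormalLiftingFromClassLifting.Glue.liftsFormally_of_stepClassLifting
    hE₁ hstar fun n F hF hres =>
    hS p k d 𝒳 h𝒳 hproj hp hO hΩ hd E₁ hE₁ hr n F hF hres (hE p k d 𝒳 h𝒳 hproj hp hO hΩ E₁ hE₁ hr n F hF hres)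

/-- **The crux BY NAME from the three statements** (case split on the typed disjunction
`d ≤ 3 ∨ Ω¹ free`; the `Ω¹`-free half is carried, not addressed). -/
theorem FormalLiftingFromClassLifting_of (hE : DetEngine) (hS : StepClassLiftingFromDet)
    (hΩ₁ : CruxOmegaFree) : FormalLiftingFromClassLifting := by
  intro p _ k _ _ _ d 𝒳 h𝒳 hproj hp hO hΩ hdisj E₁ hE₁ hstar hr
  rcases hdisj with hd | hfree
  · exact liftsFormally_lowDim_of_detEngine_of_stepFromDet hE hS p k d 𝒳 h𝒳 hproj hp hO hΩ hd E₁ hE₁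
      hstar hr
  · exact hΩ₁ p k d 𝒳 h𝒳 hproj hp hO hΩ hfree E₁ hE₁ hstar hr

/-- Sanity: the `d ≤ 2` corner of `StepClassLiftingFromDet` needs none of the torsion / pro-class /
bound hypotheses — it is implied by the first lemma outright. -/
theorem stepFromDet_lowDim_of_surface (h : SurfaceStepClassLiftingFromDet)
    (p : ℕ) [Fact p.Prime] (k : Type) [Field k] [CharP k p] [PerfectRing k p] (d : ℕ)
    (𝒳 : SchemeOver (WittVector p k)) (h𝒳 : IsSmoothProperModel d 𝒳)
    (hproj : Crystalline.IsProjectiveOverRing 𝒳) (hd : d ≤ 2)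
    (n : ℕ) (F : (thickening 𝒳 (n + 1)).left.Modules) (hF : IsFiniteLocallyFree F)
    (hdet : DetExtends 𝒳 n F) : ClassLiftsOneStep 𝒳 n F hF :=
  h p k d 𝒳 h𝒳 hproj hd n F hF hdet

end

end Summit.HodgeConjecture.HodgeConjecture.Cruxes.FormalLiftingFromClassLifting.IdeatorFive
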